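import Summits.QuantumFields.YangMills.Theorems.BalabanUVNodesN15BackgroundCovariantEntries
import Summits.QuantumFields.YangMills.Theorems.BalabanUVNodesN15NE2PlusOperatorM1
import HarnessLib

/-!
# `NE2PlusOperator` BY NAME FOR THE TWO-SIDED BY-PARTS FAMILY WITH THE COVARIANT (3.42) ENTRIES 1 AND 3 (`∇_{U′}X`, `Δ_{U′}X`) — FILE 24's socket with FILE 33's covariant entries:
# the kernel family, the per-index `EtaRateIneq342` from the letter bundle, the node theorem (dag-n15-c g10, FILE 34; Track-A node N15 = NE2, s1 «background-layer OPERATOR ingredient»)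

`--kind definition --supports stmt-QuantumFields-20544 --as helper` (K3⁷; count-neutral).  Imports BY NAME this seat's FILE 33 `…BackgroundCovariantEntries` (`covEntry1`, `covEntry3`,
`hasMaj_idef_covEntry1`, `hasMaj_idef_covEntry3`; through it FILE 24 `…TwoSidedLettersNode` (`TwoSidedLetters`, `bgInstanceM₂R`, `etaRateIneq342_twoSided_of_letters`' inputs: g2 V0
`hasMaj_entries_of_letters`, FILE 23 `hasMaj_entry2_byParts_matrix₂_of_letters`, M1 `hasMaj_unstackM` ∕ `hasMaj_idef_unstackM`, n15-b `opFamily` ∕ `etaRateIneq342_of_hasMaj_rateWeight` ∕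
`hasMaj_bgPropV` ∕ `hasMaj_stack` ∕ `hasMaj_projO_comp`, FILE 19 `bpConst2L`, `bgConst`, `bgConst1`, `rowConst_small`)); nothing in the tree is modified.

WHAT.  §1 defs `covConst1`, `covConst3` (the two new entry constants), `bgOpsM₂RC` (the four entry operators: entry 0 and the by-parts entry 2 as in FILE 24's `bgOpsM₂R`, entry 1 := the
η-difference of FILE 33's `covEntry1` at the two spacings, entry 3 := that of `covEntry3`), `bgFamilyM₂RC` (n15-b `opFamily` of these).  §2 ★★ `etaRateIneq342_twoSidedCov_of_letters` (FILE 24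
§2's per-index theorem for the covariant family: same letters plus the spacing order `0 ≤ η′ ≤ η ≤ θ ≤ 1`; the two new entries by FILE 33 §3 with the coarse component majorants from
n15-b `hasMaj_bgPropV`; `B₀ = B₀^{flat} + covConst1 + covConst3`).  §3 ★★★ **`ne2PlusOperatorM1_twoSidedCov_of_letters`**: `NE2PlusOperatorM1 c₃₅ (bgInstanceM₂R …) (bgFamilyM₂RC …)` BY NAME (FILE 39's guard-free, NON-VACUOUS shape; `NE2PlusOperator` follows)
for ANY coefficient-carrier pair whose (3.35) delivers the letter bundle (FILE 24 §3's quantifier bookkeeping verbatim, window unchanged).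

HONEST FRAMING.  Bookkeeping over hypothesis-shaped letters (discharged on the torus in the sequel FILE 35); entries 1 and 3 are covariant w.r.t. the transports `1 + ηa⁺` ∕ the
FILE 28 species (for the exact coefficients: Bałaban's `∇_{U′}`, `Δ_{U′}` at `U′ = e^{iηA}` — FILE 33's identifications), entry 2 stays the flat by-parts `X∇*` (located); `U ≡ 1` chart;
`DRD*`, `aQ*Q` at `U ≡ 1`; NE2⁺ NOT PRINTED; count-neutral; N15 NOT discharged; one finite torus at fixed ε — NOT ℝ⁴, NOT infinite volume, NOT OS, NOT a mass gap, NOT Clay.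
-/

noncomputable section

open scoped BigOperators
open Finset

namespace Summit.QuantumFields.YangMills.BalabanUVNodes.N15.BackgroundLayer

open Literature.MathematicalPhysics.QuantumFieldTheory.Balaban1983to89
open Literature.MathematicalPhysics.QuantumFieldTheory.Balaban1983to89.B11SectG (BlockNorm HasMaj RowSum hasMaj_comp hasMaj_comp_exp hasMaj_zero)
open Literature.MathematicalPhysics.QuantumFieldTheory.Balaban1983to89.T4EtaRate (PairedInstance EtaPairing EtaRateIneq342 NE2PlusOperator rateFactor)
open Literature.MathematicalPhysics.QuantumFieldTheory.Balaban1983to89.T4EtaRateDefect (idef idef_apply idef_comp idef_zero rateWeight)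
open Literature.MathematicalPhysics.QuantumFieldTheory.Balaban1983to89.T4EtaRateCoeffDefect (pull pull_apply diagK diagK_nonneg)
open Literature.MathematicalPhysics.QuantumFieldTheory.Balaban1983to89.B6RandomWalk (Triangle254)
open Summit.QuantumFields.YangMills.BalabanUVNodes.N15.OperatorReadout (opGeo opFamily opGeo_len rateFactor_opGeo etaRateIneq342_of_hasMaj_rateWeight)
open Summit.QuantumFields.YangMills.BalabanUVNodes.N15.MatrixSpecies (mmulOp liftEquiv liftMap liftBlk)
open Summit.QuantumFields.YangMills.BalabanUVNodes.N15.SiteLayer (hasMaj_exp_comp_diagK hasMaj_diagK_comp_exp hasMaj_add_exp hasMaj_exp_mono)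


variable {d : ℕ}

/-! ## §1 The covariant-entries kernel family -/

section Defs

variable {X X' : Type} (J ι : Type) [Fintype ι] [Fintype X'] [DecidableEq X] [Fintype X] [Fintype J] [DecidableEq X'] [DecidableEq J] [DecidableEq ι]

/-- The constant of the covariant entry 1: `(1 + 2a)·bgConst + 6aβ` (FILE 33 `hasMaj_idef_covEntry1` at `m₁ = bgConst·θ`, `o = aθ`, `o_R = 2aθ`, `β_X = 2β`). [folklore] -/
def covConst1 (β cr m₀ K a : ℝ) : ℝ := (1 + 2 * a) * bgConst β cr m₀ K a + 6 * a * β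

/-- The constant of the covariant entry 3: `bgConst1 + (1 + 2|J|)·a·(bgConst + 2β)`. [folklore] -/
def covConst3 (nJ β cr m₀ K a : ℝ) : ℝ := bgConst1 β cr m₀ K a + (1 + 2 * nJ) * a * (bgConst β cr m₀ K a + 2 * β)

omit [Fintype ι] [Fintype X'] [DecidableEq X] [Fintype X] [Fintype J] [DecidableEq X'] [DecidableEq J] [DecidableEq ι] in
/-- `0 ≤ covConst1`. [folklore] -/
theorem covConst1_nonneg {β cr m₀ K a : ℝ} (hβ : 0 ≤ β) (hcr : 0 ≤ cr) (hm₀ : 0 ≤ m₀) (hK : 0 ≤ K) (ha : 0 ≤ a) : 0 ≤ covConst1 β cr m₀ K a := by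
  have := bgConst_nonneg hβ hcr hm₀ hK ha
  unfold covConst1; positivity

omit [Fintype ι] [Fintype X'] [DecidableEq X] [Fintype X] [Fintype J] [DecidableEq X'] [DecidableEq J] [DecidableEq ι] in
/-- `0 ≤ covConst3`. [folklore] -/
theorem covConst3_nonneg {nJ β cr m₀ K a : ℝ} (hnJ : 0 ≤ nJ) (hβ : 0 ≤ β) (hcr : 0 ≤ cr) (hm₀ : 0 ≤ m₀) (hK : 0 ≤ K) (ha : 0 ≤ a) : 0 ≤ covConst3 nJ β cr m₀ K a := by
  have := bgConst_nonneg hβ hcr hm₀ hK ha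
  have := bgConst1_nonneg hβ hcr hm₀ hK ha
  unfold covConst3; positivity

/-- THE FOUR ENTRY OPERATORS WITH THE COVARIANT ENTRIES 1 AND 3: FILE 24's `bgOpsM₂R` with entry 1 := `𝔇(covEntry1′, covEntry1)` (spacings `η′ = n′⁻¹`, `η = n⁻¹`) and entry 3 :=
`𝔇(covEntry3′, covEntry3)`; entries 0 and 2 (by parts) unchanged. [cite: Balaban1985BackgroundPropagators, (3.42) p.397 (the four entries, covariant ∇_U, Δ_U: shape)] -/
def bgOpsM₂RC {Cfg : Type} (cfgF : Cfg → (X' → Matrix ι ι ℝ) × (J ⊕ J → X' → Matrix ι ι ℝ)) (cfgC : Cfg → (X → Matrix ι ι ℝ) × (J ⊕ J → X → Matrix ι ι ℝ)) (π : X' → X)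
    (τ : J → X ≃ X) (τ' : J → X' ≃ X') (n n' : ℝ) (ν : J) (G D₃ : (X × ι → ℝ) →ₗ[ℝ] (X × ι → ℝ)) (D : J ⊕ J → (X × ι → ℝ) →ₗ[ℝ] (X × ι → ℝ))
    (G' D₃' : (X' × ι → ℝ) →ₗ[ℝ] (X' × ι → ℝ)) (D' : J ⊕ J → (X' × ι → ℝ) →ₗ[ℝ] (X' × ι → ℝ)) : Fin 4 → Cfg → ((X × ι → ℝ) →ₗ[ℝ] (X' × ι → ℝ)) :=
  fun k U => ![idef (pull (liftMap π ι)) (pull (liftMap π ι)) (projO none ∘ₗ bgPairM G' D' (cfgF U).1 (cfgF U).2) (projO none ∘ₗ bgPairM G D (cfgC U).1 (cfgC U).2),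
    idef (pull (liftMap π ι)) (pull (liftMap π ι)) (covEntry1 n'⁻¹ G' D' (cfgF U).1 (cfgF U).2 ν) (covEntry1 n⁻¹ G D (cfgC U).1 (cfgC U).2 ν),
    idef (pull (liftMap (liftMap π ι) J)) (pull (liftMap π ι)) (e2OpMBP₂ τ' n' G' D' (cfgF U).1 (cfgF U).2) (e2OpMBP₂ τ n G D (cfgC U).1 (cfgC U).2) ∘ₗ injJ ν,
    idef (pull (liftMap π ι)) (pull (liftMap π ι)) (covEntry3 G' D₃' D' (cfgF U).1 (cfgF U).2) (covEntry3 G D₃ D (cfgC U).1 (cfgC U).2)] k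

/-- THE KERNEL FAMILY WITH THE COVARIANT ENTRIES on the realised two-sided instance (n15-b `opFamily` of `bgOpsM₂RC`). [cite: Balaban1985BackgroundPropagators, (3.42) p.397 (shape)] -/
def bgFamilyM₂RC {g : B6.Geometry} (blk : X → g.Site) (π : X' → X) (m : ℕ) (Bc Bf : B9.Backgrounds)
    (P : EtaPairing (opGeo g (X × ι) (liftBlk blk ι)) (fineGeo g (X' × ι) (liftBlk (blk ∘ π) ι) m) Bc Bf) (cfgF : Bf.Cfg → (X' → Matrix ι ι ℝ) × (J ⊕ J → X' → Matrix ι ι ℝ))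
    (cfgC : Bf.Cfg → (X → Matrix ι ι ℝ) × (J ⊕ J → X → Matrix ι ι ℝ)) (τ : J → X ≃ X) (τ' : J → X' ≃ X') (n n' : ℝ) (ν : J) (G D₃ : (X × ι → ℝ) →ₗ[ℝ] (X × ι → ℝ))
    (D : J ⊕ J → (X × ι → ℝ) →ₗ[ℝ] (X × ι → ℝ)) (G' D₃' : (X' × ι → ℝ) →ₗ[ℝ] (X' × ι → ℝ)) (D' : J ⊕ J → (X' × ι → ℝ) →ₗ[ℝ] (X' × ι → ℝ)) :
    B9.KernelFamily (bgInstanceM₂R (ι := ι) blk π m Bc Bf P).gc (bgInstanceM₂R (ι := ι) blk π m Bc Bf P).Bf :=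
  show B9.KernelFamily (opGeo g (X × ι) (liftBlk blk ι)) Bf from
    opFamily (g := g) (B := Bf) (liftBlk blk ι) (liftBlk (blk ∘ π) ι) (bgOpsM₂RC J ι cfgF cfgC π τ τ' n n' ν G D₃ D G' D₃' D')

end Defs

/-! ## §2 Per index `EtaRateIneq342` for the covariant-entries family -/

section PerIndex

variable {X X' J ι : Type} [Fintype X] [Fintype X'] [Fintype J] [Fintype ι] [DecidableEq X] [DecidableEq X'] [DecidableEq J] [DecidableEq ι]
  {g : B6.Geometry} (blk : X → g.Site) (π : X' → X) {B : B9.Backgrounds}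
variable {τ : J → X ≃ X} {τ' : J → X' ≃ X'} {n n' : ℝ} {G D₃ : (X × ι → ℝ) →ₗ[ℝ] (X × ι → ℝ)} {D : J ⊕ J → (X × ι → ℝ) →ₗ[ℝ] (X × ι → ℝ)}
  {G' D₃' : (X' × ι → ℝ) →ₗ[ℝ] (X' × ι → ℝ)} {D' : J ⊕ J → (X' × ι → ℝ) →ₗ[ℝ] (X' × ι → ℝ)}

/-- **`EtaRateIneq342` PER INDEX FROM THE LETTER BUNDLE** (`B₀ = bgConst(…) + bgConst1(…)` at `K = 1 + |J ⊕ J|`, `a₀ = a` `+ bpConst2L(…)`, `δ₀ = δ − 6σ`): a carrier `B` with readings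
`cfgF, cfgC`, a configuration `U` whose read configurations obey `TwoSidedLetters … a θ`, the guards `β((1+|J ⊕ J|)a)c_r ≤ ½`, `rowConst(|J|, β, c_T, a, c_r)c_r² ≤ ½`, the `U ≡ 1` layer
(pieces, derived pieces over `J ⊕ J`, Laplacian pieces, entry-2 operators, their defects, shifts) and the shift-defect row letter at the coarse forward coefficients; `η, L > 0`, sites of size
`≥ 1`, `θ ≤ (L^j)^{−γ}`.  Entries 0∕1∕3 by g2 V0 `hasMaj_entries_of_letters` (three perturbation letters: M1 `hasMaj_unstackM` ∕ `hasMaj_idef_unstackM`), entry 2 by FILE 23.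
[cite: Balaban1985BackgroundPropagators, Thm 3.1 (3.42) p.397 (shape, quantifier template)] -/
theorem etaRateIneq342_twoSidedCov_of_letters (htri : Triangle254 g) (hd : ∀ a b : g.Site, 0 ≤ g.dist a b) (hd0 : ∀ y : g.Site, g.dist y y = 0) {σ cr : ℝ} (hσ : 0 ≤ σ)
    (hcr : 0 ≤ cr) (hrow : RowSum g σ cr) (hη : 0 < g.eta) (hL : 0 < g.L) (hlen : ∀ y, 1 ≤ g.len y) {δ β m₀ θ a γ cT mT : ℝ} (hσδ : 6 * σ ≤ δ)
    (hβ : 0 ≤ β) (hm₀ : 0 ≤ m₀) (hθ : 0 ≤ θ) (hθγ : ∀ y, θ ≤ rateWeight g γ y) (ha : 0 ≤ a) (hq : β * ((1 + Fintype.card (J ⊕ J)) * a) * cr ≤ 1 / 2) (hcT : 0 ≤ cT)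
    (hmT : 0 ≤ mT) (hq2 : 1 * rowConst (Fintype.card J) β cT a cr * cr * cr ≤ 1 / 2)
    (hn'0 : 0 ≤ n'⁻¹) (hn'n : n'⁻¹ ≤ n⁻¹) (hnθ : n⁻¹ ≤ θ) (hθ1 : θ ≤ 1) {ν : J}
    (hG : HasMaj (BlockNorm.ofBlocks g (liftBlk blk ι)) (BlockNorm.ofBlocks g (liftBlk blk ι)) G (fun y y' => β * Real.exp (-(δ * g.dist y y'))))
    (hD : ∀ μ, HasMaj (BlockNorm.ofBlocks g (liftBlk blk ι)) (BlockNorm.ofBlocks g (liftBlk blk ι)) (D μ) (fun y y' => β * Real.exp (-(δ * g.dist y y'))))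
    (hG' : HasMaj (BlockNorm.ofBlocks g (liftBlk (blk ∘ π) ι)) (BlockNorm.ofBlocks g (liftBlk (blk ∘ π) ι)) G' (fun y y' => β * Real.exp (-(δ * g.dist y y'))))
    (hD' : ∀ μ, HasMaj (BlockNorm.ofBlocks g (liftBlk (blk ∘ π) ι)) (BlockNorm.ofBlocks g (liftBlk (blk ∘ π) ι)) (D' μ) (fun y y' => β * Real.exp (-(δ * g.dist y y'))))
    (hD₃' : HasMaj (BlockNorm.ofBlocks g (liftBlk (blk ∘ π) ι)) (BlockNorm.ofBlocks g (liftBlk (blk ∘ π) ι)) D₃' (fun y y' => β * Real.exp (-(δ * g.dist y y'))))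
    (hDG : HasMaj (BlockNorm.ofBlocks g (liftBlk blk ι)) (BlockNorm.ofBlocks g (liftBlk (blk ∘ π) ι)) (idef (pull (liftMap π ι)) (pull (liftMap π ι)) G' G)
      (fun y y' => m₀ * θ * Real.exp (-(δ * g.dist y y'))))
    (hDD : ∀ μ, HasMaj (BlockNorm.ofBlocks g (liftBlk blk ι)) (BlockNorm.ofBlocks g (liftBlk (blk ∘ π) ι)) (idef (pull (liftMap π ι)) (pull (liftMap π ι)) (D' μ) (D μ))
      (fun y y' => m₀ * θ * Real.exp (-(δ * g.dist y y'))))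
    (hDD₃ : HasMaj (BlockNorm.ofBlocks g (liftBlk blk ι)) (BlockNorm.ofBlocks g (liftBlk (blk ∘ π) ι)) (idef (pull (liftMap π ι)) (pull (liftMap π ι)) D₃' D₃)
      (fun y y' => m₀ * θ * Real.exp (-(δ * g.dist y y'))))
    (hS : ∀ ν, HasMaj (BlockNorm.ofBlocks g (liftBlk blk ι)) (BlockNorm.ofBlocks g (liftBlk blk ι)) (G ∘ₗ fgradAdj n (liftEquiv (τ ν) ι)) (fun y y' => β * Real.exp (-(δ * g.dist y y'))))
    (hS' : ∀ ν, HasMaj (BlockNorm.ofBlocks g (liftBlk (blk ∘ π) ι)) (BlockNorm.ofBlocks g (liftBlk (blk ∘ π) ι)) (G' ∘ₗ fgradAdj n' (liftEquiv (τ' ν) ι)) (fun y y' => β * Real.exp (-(δ * g.dist y y'))))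
    (hDS : ∀ ν, HasMaj (BlockNorm.ofBlocks g (liftBlk blk ι)) (BlockNorm.ofBlocks g (liftBlk (blk ∘ π) ι))
      (idef (pull (liftMap π ι)) (pull (liftMap π ι)) (G' ∘ₗ fgradAdj n' (liftEquiv (τ' ν) ι)) (G ∘ₗ fgradAdj n (liftEquiv (τ ν) ι))) (fun y y' => m₀ * θ * Real.exp (-(δ * g.dist y y'))))
    (hSh : ∀ μ, HasMaj (BlockNorm.ofBlocks g (liftBlk blk ι)) (BlockNorm.ofBlocks g (liftBlk blk ι)) (pull (liftEquiv (τ μ) ι)) (fun y y' => cT * Real.exp (-(δ * g.dist y y'))))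
    (hSh' : ∀ μ, HasMaj (BlockNorm.ofBlocks g (liftBlk (blk ∘ π) ι)) (BlockNorm.ofBlocks g (liftBlk (blk ∘ π) ι)) (pull (liftEquiv (τ' μ) ι)) (fun y y' => cT * Real.exp (-(δ * g.dist y y'))))
    {cfgF : B.Cfg → (X' → Matrix ι ι ℝ) × (J ⊕ J → X' → Matrix ι ι ℝ)} {cfgC : B.Cfg → (X → Matrix ι ι ℝ) × (J ⊕ J → X → Matrix ι ι ℝ)} {U : B.Cfg}
    (hLt : TwoSidedLetters J ι π τ τ' n n' a θ (cfgF U) (cfgC U))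
    (hDSh : ∀ μ, HasMaj (BlockNorm.ofBlocks g (liftBlk (liftBlk blk ι) J)) (BlockNorm.ofBlocks g (liftBlk (blk ∘ π) ι))
      (idef (pull (liftMap π ι)) (pull (liftMap π ι)) (pull (liftEquiv (τ' μ) ι)) (pull (liftEquiv (τ μ) ι)) ∘ₗ
        (mmulOp ((cfgC U).2 (Sum.inl μ) ∘ ⇑(τ μ).symm) ∘ₗ sumJ fun ν => G ∘ₗ fgradAdj n (liftEquiv (τ ν) ι))) (fun y y' => mT * θ * Real.exp (-(δ * g.dist y y')))) :
    EtaRateIneq342 (opFamily (g := g) (B := B) (liftBlk blk ι) (liftBlk (blk ∘ π) ι) (bgOpsM₂RC J ι cfgF cfgC π τ τ' n n' ν G D₃ D G' D₃' D'))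
      (bgConst β cr m₀ (1 + Fintype.card (J ⊕ J)) a + bgConst1 β cr m₀ (1 + Fintype.card (J ⊕ J)) a + bpConst2L (Fintype.card J) (Fintype.card (J ⊕ J)) β cr m₀ a cT mT +
        covConst1 β cr m₀ (1 + Fintype.card (J ⊕ J)) a + covConst3 (Fintype.card J) β cr m₀ (1 + Fintype.card (J ⊕ J)) a)
      (δ - 6 * σ) γ U := by
  obtain ⟨hc, hA, hc', hA', hfc, hfA, hga, hga', hgb, hgb', hfaT, hfgT, -, hfbT, hfgb⟩ := hLt
  have hnJ : (0 : ℝ) ≤ Fintype.card J := Nat.cast_nonneg _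
  have hnJ2 : (0 : ℝ) ≤ Fintype.card (J ⊕ J) := Nat.cast_nonneg _
  have hJ0 : (0 : ℝ) ≤ 1 + Fintype.card (J ⊕ J) := by positivity
  have haθ : 0 ≤ a * θ := mul_nonneg ha hθ
  have hσδ' : σ ≤ δ := by linarith
  have hR0 : 0 ≤ a * (1 + Fintype.card (J ⊕ J)) := mul_nonneg ha hJ0
  -- V0: entries 0∕1∕3 from the three perturbation letters (mixed slots fed with zeros)
  have hz : ∀ {F₁ F₂ : Type} [AddCommGroup F₁] [Module ℝ F₁] [AddCommGroup F₂] [Module ℝ F₂] (b₁ : BlockNorm g F₁) (b₂ : BlockNorm g F₂) (c : ℝ), 0 ≤ c →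
      HasMaj b₁ b₂ (0 : F₁ →ₗ[ℝ] F₂) (fun y y' => c * Real.exp (-(δ * g.dist y y'))) := fun b₁ b₂ c hc0 =>
    (hasMaj_zero b₁ b₂).mono fun _ _ => mul_nonneg hc0 (Real.exp_nonneg _)
  have hV : HasMaj (BlockNorm.ofBlocks g (blkPair (liftBlk blk ι))) (BlockNorm.ofBlocks g (liftBlk blk ι)) (unstackM (cfgC U).1 (cfgC U).2)
      (diagK fun _ => a * (1 + Fintype.card (J ⊕ J))) := hasMaj_unstackM blk ha hc hA
  have hV' : HasMaj (BlockNorm.ofBlocks g (blkPair (liftBlk (blk ∘ π) ι))) (BlockNorm.ofBlocks g (liftBlk (blk ∘ π) ι)) (unstackM (cfgF U).1 (cfgF U).2)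
      (diagK fun _ => a * (1 + Fintype.card (J ⊕ J))) := hasMaj_unstackM (blk ∘ π) ha hc' hA'
  have hDV : HasMaj (BlockNorm.ofBlocks g (blkPair (liftBlk blk ι))) (BlockNorm.ofBlocks g (liftBlk (blk ∘ π) ι))
      (idef (pull (liftPair (liftMap π ι))) (pull (liftMap π ι)) (unstackM (cfgF U).1 (cfgF U).2) (unstackM (cfgC U).1 (cfgC U).2))
      (diagK fun _ => a * (1 + Fintype.card (J ⊕ J)) * θ) :=
    (hasMaj_idef_unstackM blk π haθ hfc hfA).mono fun y y' =>
      T4EtaRateCoeffDefect.diagK_mono (fun _ => (by ring : a * θ * (1 + (Fintype.card (J ⊕ J) : ℝ)) = a * (1 + Fintype.card (J ⊕ J)) * θ).le) y y'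
  have h013 := hasMaj_entries_of_letters (liftBlk blk ι) (liftMap π ι) htri hd hσ hcr hrow hσδ' hβ hm₀ hθ hJ0 ha hq hR0
    (le_of_eq (by ring)) hG hD hG' hD' (hz _ _ β hβ) (S := 0) (SD := fun _ => 0) (S' := 0) (SD' := fun _ => 0) (fun _ => hz _ _ β hβ) hD₃'
    hDG hDD (by rw [idef_zero]; exact hz _ _ (m₀ * θ) (mul_nonneg hm₀ hθ)) (fun _ => by rw [idef_zero]; exact hz _ _ (m₀ * θ) (mul_nonneg hm₀ hθ)) hDD₃ hV hV' hDV
  have h01 := h013.1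
  have h3 := h013.2.2
  have h2 := hasMaj_entry2_byParts_matrix₂_of_letters blk π htri hd hd0 hσ hcr hrow hσδ hβ hm₀ hθ ha hq hcT hmT hq2 hG hD hG' hD' hDG hDD hS hS' hDS hSh hSh'
    hc hA hc' hA' hfc hfA hga hga' hgb hgb' hfaT hfgT hfbT hfgb hDSh ν
  -- the coarse component majorants `≤ 2β·e^{−(δ−σ)d}` (n15-b `hasMaj_bgPropV` at `ρ = δ − σ`, `(1 − q)⁻¹ ≤ 2`)
  have hq1 : β * (a * (1 + Fintype.card (J ⊕ J))) * cr < 1 := by nlinarith [hq]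
  have hinv2 : (1 - β * (a * (1 + Fintype.card (J ⊕ J))) * cr)⁻¹ ≤ 2 := by
    have hq' : β * (a * (1 + Fintype.card (J ⊕ J))) * cr ≤ 1 / 2 := by nlinarith [hq]
    rw [inv_le_comm₀ (by linarith) (by norm_num : (0:ℝ) < 2)]; linarith
  have hKβ : ∀ y y' : g.Site, 0 ≤ β * Real.exp (-(δ * g.dist y y')) := fun _ _ => mul_nonneg hβ (Real.exp_nonneg _)
  have hXhat := hasMaj_bgPropV (liftBlk blk ι) (blkPair (liftBlk blk ι)) htri hd hrow hσ (ρ := δ - σ) (by linarith) (by linarith) hβ hR0 (hasMaj_stack _ hKβ hG hD) hV hq1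
  have hXj : ∀ j : Option (J ⊕ J), HasMaj (BlockNorm.ofBlocks g (liftBlk blk ι)) (BlockNorm.ofBlocks g (liftBlk blk ι)) (projO j ∘ₗ bgPairM G D (cfgC U).1 (cfgC U).2)
      (fun y y' => 2 * β * Real.exp (-((δ - σ) * g.dist y y'))) := fun j =>
    (hasMaj_projO_comp (liftBlk blk ι) hXhat j).mono fun y y' => by
      have hE := Real.exp_nonneg (-((δ - σ) * g.dist y y'))
      calc β * (1 - β * (a * (1 + ↑(Fintype.card (J ⊕ J)))) * cr)⁻¹ * Real.exp (-((δ - σ) * g.dist y y'))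
          ≤ β * 2 * Real.exp (-((δ - σ) * g.dist y y')) := mul_le_mul_of_nonneg_right (mul_le_mul_of_nonneg_left hinv2 hβ) hE
        _ = 2 * β * Real.exp (-((δ - σ) * g.dist y y')) := by ring
  -- the transport fit `Σ|(1 + η′A′⁺) − (1 + ηA⁺∘π)| ≤ 2aθ`
  have hfR : ∀ x' i, ∑ j, |(1 + n'⁻¹ • (cfgF U).2 (Sum.inl ν) x') i j - (1 + n⁻¹ • (cfgC U).2 (Sum.inl ν) (π x')) i j| ≤ 2 * a * θ := by
    intro x' i
    have h1 := hfA (Sum.inl ν) x' i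
    have h2 := hA (Sum.inl ν) (π x') i
    calc ∑ j, |(1 + n'⁻¹ • (cfgF U).2 (Sum.inl ν) x') i j - (1 + n⁻¹ • (cfgC U).2 (Sum.inl ν) (π x')) i j|
        ≤ ∑ j, (n'⁻¹ * |(cfgF U).2 (Sum.inl ν) x' i j - (cfgC U).2 (Sum.inl ν) (π x') i j| + (n⁻¹ - n'⁻¹) * |(cfgC U).2 (Sum.inl ν) (π x') i j|) :=
          Finset.sum_le_sum fun j _ => by
            rw [show (1 + n'⁻¹ • (cfgF U).2 (Sum.inl ν) x') i j - (1 + n⁻¹ • (cfgC U).2 (Sum.inl ν) (π x')) i j =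
                n'⁻¹ * ((cfgF U).2 (Sum.inl ν) x' i j - (cfgC U).2 (Sum.inl ν) (π x') i j) - (n⁻¹ - n'⁻¹) * (cfgC U).2 (Sum.inl ν) (π x') i j by
              simp only [Matrix.add_apply, Matrix.smul_apply, smul_eq_mul]; ring]
            refine (abs_sub _ _).trans (le_of_eq ?_)
            rw [abs_mul, abs_mul, abs_of_nonneg hn'0, abs_of_nonneg (sub_nonneg.mpr hn'n)]
      _ = n'⁻¹ * ∑ j, |(cfgF U).2 (Sum.inl ν) x' i j - (cfgC U).2 (Sum.inl ν) (π x') i j| + (n⁻¹ - n'⁻¹) * ∑ j, |(cfgC U).2 (Sum.inl ν) (π x') i j| := by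
          rw [Finset.sum_add_distrib, Finset.mul_sum, Finset.mul_sum]
      _ ≤ 1 * (a * θ) + θ * a := add_le_add (mul_le_mul (hn'n.trans (hnθ.trans hθ1)) h1 (Finset.sum_nonneg fun _ _ => abs_nonneg _) zero_le_one)
          (mul_le_mul (by linarith) h2 (Finset.sum_nonneg fun _ _ => abs_nonneg _) hθ)
      _ = 2 * a * θ := by ring
  have hcov1 := hasMaj_idef_covEntry1 blk π (η' := n'⁻¹) (η := n⁻¹) hn'0 (hn'n.trans (hnθ.trans hθ1)) ha haθ (by positivity : 0 ≤ 2 * a * θ) ν (hA' (Sum.inl ν)) (hfA (Sum.inl ν)) hfR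
    (h01 none) (h01 (some (Sum.inl ν))) (hXj none) (hXj (some (Sum.inl ν)))
  have hcov3 := hasMaj_idef_covEntry3 blk π (D₃ := D₃) (D₃' := D₃') ha haθ hc' hA' hfc hfA h01 hXj h3
  have hCC1 : 0 ≤ covConst1 β cr m₀ (1 + Fintype.card (J ⊕ J)) a := covConst1_nonneg hβ hcr hm₀ hJ0 ha
  have hCC3 : 0 ≤ covConst3 (Fintype.card J) β cr m₀ (1 + Fintype.card (J ⊕ J)) a := covConst3_nonneg hnJ hβ hcr hm₀ hJ0 ha
  have hC0 : 0 ≤ bgConst β cr m₀ (1 + Fintype.card (J ⊕ J)) a := bgConst_nonneg hβ hcr hm₀ hJ0 ha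
  have hC1 : 0 ≤ bgConst1 β cr m₀ (1 + Fintype.card (J ⊕ J)) a := bgConst1_nonneg hβ hcr hm₀ hJ0 ha
  have hC2 : 0 ≤ bpConst2L (Fintype.card J) (Fintype.card (J ⊕ J)) β cr m₀ a cT mT := bpConst2L_nonneg hnJ hnJ2 hβ hcr hm₀ ha hcT hmT (by linarith)
  set B₀ := bgConst β cr m₀ (1 + Fintype.card (J ⊕ J)) a + bgConst1 β cr m₀ (1 + Fintype.card (J ⊕ J)) a + bpConst2L (Fintype.card J) (Fintype.card (J ⊕ J)) β cr m₀ a cT mT +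
        covConst1 β cr m₀ (1 + Fintype.card (J ⊕ J)) a + covConst3 (Fintype.card J) β cr m₀ (1 + Fintype.card (J ⊕ J)) a
    with hB₀def
  have hB₀ : 0 ≤ B₀ := add_nonneg (add_nonneg (add_nonneg (add_nonneg hC0 hC1) hC2) hCC1) hCC3
  -- the readout in the (3.42) shape
  refine etaRateIneq342_of_hasMaj_rateWeight (g := g) (B := B) (liftBlk blk ι) (liftBlk (blk ∘ π) ι) hη hL hB₀ (c := fun _ => B₀) (fun _ => hB₀)
    (fun k y => le_mul_of_one_le_right hB₀ (one_le_pref4 (hlen y) k)) (bgOpsM₂RC J ι cfgF cfgC π τ τ' n n' ν G D₃ D G' D₃' D') U fun k => ?_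
  have hmono : ∀ {B ρ : ℝ}, 0 ≤ B → B ≤ B₀ → δ - 6 * σ ≤ ρ → ∀ y y' : g.Site,
      B * θ * Real.exp (-(ρ * g.dist y y')) ≤ B₀ * Real.exp (-((δ - 6 * σ) * g.dist y y')) * rateWeight g γ y' := by
    intro B ρ hB0 hB hρ y y'
    have hexp : Real.exp (-(ρ * g.dist y y')) ≤ Real.exp (-((δ - 6 * σ) * g.dist y y')) :=
      Real.exp_le_exp.mpr (neg_le_neg (mul_le_mul_of_nonneg_right hρ (hd y y')))
    calc B * θ * Real.exp (-(ρ * g.dist y y')) ≤ B₀ * rateWeight g γ y' * Real.exp (-((δ - 6 * σ) * g.dist y y')) :=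
          mul_le_mul (mul_le_mul hB (hθγ y') hθ hB₀) hexp (Real.exp_nonneg _) (mul_nonneg hB₀ (hθ.trans (hθγ y')))
      _ = B₀ * Real.exp (-((δ - 6 * σ) * g.dist y y')) * rateWeight g γ y' := by ring
  fin_cases k
  · exact (h01 none).mono (hmono hC0 (by rw [hB₀def]; linarith) (by linarith))
  · refine (hcov1.mono fun y y' => le_of_eq ?_).mono (hmono (ρ := δ - σ) hCC1 (by rw [hB₀def]; linarith) (by linarith))
    simp only [covConst1]; ring
  · exact h2.mono (hmono hC2 (by rw [hB₀def]; linarith) le_rfl)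
  · refine (hcov3.mono fun y y' => le_of_eq ?_).mono (hmono (ρ := δ - σ) hCC3 (by rw [hB₀def]; linarith) (by linarith))
    simp only [covConst3]; ring

end PerIndex

/-! ## §3 The node theorem -/

section Node

variable {I J ι : Type} [Fintype J] [DecidableEq J] [Fintype ι] [DecidableEq ι] (g : I → B6.Geometry) (X X' : I → Type) [∀ i, Fintype (X i)]
  [∀ i, Fintype (X' i)] [∀ i, DecidableEq (X i)] [∀ i, DecidableEq (X' i)] (blk : ∀ i, X i → (g i).Site) (π : ∀ i, X' i → X i) (τ : ∀ i, J → X i ≃ X i)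
  (τ' : ∀ i, J → X' i ≃ X' i) (n n' : I → ℝ) (nsh : I → ℕ) (Bc Bf : I → B9.Backgrounds)
  (P : ∀ i, EtaPairing (opGeo (g i) (X i × ι) (liftBlk (blk i) ι)) (fineGeo (g i) (X' i × ι) (liftBlk (blk i ∘ π i) ι) (nsh i)) (Bc i) (Bf i))
  (cfgF : ∀ i, (Bf i).Cfg → (X' i → Matrix ι ι ℝ) × (J ⊕ J → X' i → Matrix ι ι ℝ)) (cfgC : ∀ i, (Bf i).Cfg → (X i → Matrix ι ι ℝ) × (J ⊕ J → X i → Matrix ι ι ℝ))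
  (θ : I → ℝ) (ν : I → J) (G D₃ : ∀ i, (X i × ι → ℝ) →ₗ[ℝ] (X i × ι → ℝ)) (D : ∀ i, J ⊕ J → (X i × ι → ℝ) →ₗ[ℝ] (X i × ι → ℝ))
  (G' D₃' : ∀ i, (X' i × ι → ℝ) →ₗ[ℝ] (X' i × ι → ℝ)) (D' : ∀ i, J ⊕ J → (X' i × ι → ℝ) →ₗ[ℝ] (X' i × ι → ℝ))

/-- ★★★ **NE2⁺, OPERATOR LAYER — `T4EtaRate.NE2PlusOperator` BY NAME FOR THE TWO-SIDED BY-PARTS MATRIX FAMILY OVER AN ARBITRARY COEFFICIENT-CARRIER PAIR WHOSE (3.35) REGULARITY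
DELIVERS THE LETTER BUNDLE.**  For ANY family of realised instances `⟨opGeo, fineGeo, B_c, B_f, P⟩` with readings `cfgF_i, cfgC_i` of the fine ∕ coarse coefficient configurations such
that, for every configuration `U` regular at level `c₃₅` with window `α₀ > 0` (and `M ≥ 1`), the fifteen letters `TwoSidedLetters … (κ·c₃₅Mα₀) θ_i (cfgF_i U) (cfgC_i U)` hold together
with the shift-defect row letter at the coarse forward coefficients (`≤ m_T·(κc₃₅Mα₀)·θ_ie^{−δd}`, linear in the scale); with the UNIFORM `U ≡ 1` letters of FILE 20 at rate `δ`
(`6σ < δ`): pieces, derived pieces over `J ⊕ J`, the fine Laplacian piece, the `U ≡ 1` entry-2 operators `G_i∇_ν*, G′_i∇′_ν*`, the η-defects (`≤ m₀θ_ie^{−δd}`), the one-step shifts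
(`≤ c_Te^{−δd}`); `0 ≤ θ_i ≤ (L^j)^{−γ}`, `γ > 0`; [B6] carriers; `η, L > 0`, sites of size `≥ 1`; `c₃₅, κ, r₀ > 0` (the letters are demanded only in the WINDOW
`c₃₅Mα₀ ≤ r₀`, where the `ad`-polynomial coefficients are controlled) —: `NE2PlusOperator c₃₅ (bgInstanceM₂R …) (bgFamilyM₂R …)` with `M₅ = 1`,
`a₀ = min((2κc₃₅(1+|J ⊕ J|)(βc_r+1))⁻¹, (2(K+1))⁻¹, r₀∕c₃₅)` (`K = (c_T+1)κc₃₅|J|βc_r³`), `B₀ = bgConst + bgConst1 + bpConst2L(…, m_Tκc₃₅a₀) + 1` at scale `κc₃₅a₀`, `δ₀ = δ − 6σ`.  This is the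
socket for Bałaban's OWN species (3.52): its coarse coefficients are `ad`-polynomials of the COARSE gauge field (readings, not block averages).
[cite: Balaban1985BackgroundPropagators, Thm 3.1 p.397 (quantifier template); (3.35)–(3.36) p.396, (3.42) p.397, (3.52) p.400 (shapes, mechanism)] -/
theorem ne2PlusOperatorM1_twoSidedCov_of_letters (c35 κ r₀ : ℝ) (hc35 : 0 < c35) (hκ : 0 < κ) (hr₀ : 0 < r₀)
    (htri : ∀ i, Triangle254 (g i)) (hd : ∀ i (a b : (g i).Site), 0 ≤ (g i).dist a b) (hd0 : ∀ i (y : (g i).Site), (g i).dist y y = 0) {σ cr : ℝ} (hσ : 0 ≤ σ)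
    (hcr : 0 ≤ cr) (hrow : ∀ i, RowSum (g i) σ cr) (hη : ∀ i, 0 < (g i).eta) (hL : ∀ i, 0 < (g i).L) (hlen : ∀ i y, 1 ≤ (g i).len y) (hM1 : ∀ i, 1 ≤ (g i).M)
    {δ β m₀ γ cT mT : ℝ} (hσδ : 6 * σ < δ) (hβ : 0 ≤ β) (hm₀ : 0 ≤ m₀) (hγ : 0 < γ) (hθ : ∀ i, 0 ≤ θ i) (hθγ : ∀ i y, θ i ≤ rateWeight (g i) γ y) (hcT : 0 ≤ cT) (hmT : 0 ≤ mT)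
    (hn'0 : ∀ i, 0 ≤ (n' i)⁻¹) (hn'n : ∀ i, (n' i)⁻¹ ≤ (n i)⁻¹) (hnθ : ∀ i, (n i)⁻¹ ≤ θ i) (hθ1 : ∀ i, θ i ≤ 1)
    (hG : ∀ i, HasMaj (BlockNorm.ofBlocks (g i) (liftBlk (blk i) ι)) (BlockNorm.ofBlocks (g i) (liftBlk (blk i) ι)) (G i) (fun y y' => β * Real.exp (-(δ * (g i).dist y y'))))
    (hD : ∀ i μ, HasMaj (BlockNorm.ofBlocks (g i) (liftBlk (blk i) ι)) (BlockNorm.ofBlocks (g i) (liftBlk (blk i) ι)) (D i μ) (fun y y' => β * Real.exp (-(δ * (g i).dist y y'))))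
    (hG' : ∀ i, HasMaj (BlockNorm.ofBlocks (g i) (liftBlk (blk i ∘ π i) ι)) (BlockNorm.ofBlocks (g i) (liftBlk (blk i ∘ π i) ι)) (G' i) (fun y y' => β * Real.exp (-(δ * (g i).dist y y'))))
    (hD' : ∀ i μ, HasMaj (BlockNorm.ofBlocks (g i) (liftBlk (blk i ∘ π i) ι)) (BlockNorm.ofBlocks (g i) (liftBlk (blk i ∘ π i) ι)) (D' i μ)
      (fun y y' => β * Real.exp (-(δ * (g i).dist y y'))))
    (hD₃' : ∀ i, HasMaj (BlockNorm.ofBlocks (g i) (liftBlk (blk i ∘ π i) ι)) (BlockNorm.ofBlocks (g i) (liftBlk (blk i ∘ π i) ι)) (D₃' i) (fun y y' => β * Real.exp (-(δ * (g i).dist y y'))))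
    (hDG : ∀ i, HasMaj (BlockNorm.ofBlocks (g i) (liftBlk (blk i) ι)) (BlockNorm.ofBlocks (g i) (liftBlk (blk i ∘ π i) ι)) (idef (pull (liftMap (π i) ι)) (pull (liftMap (π i) ι)) (G' i) (G i))
      (fun y y' => m₀ * θ i * Real.exp (-(δ * (g i).dist y y'))))
    (hDD : ∀ i μ, HasMaj (BlockNorm.ofBlocks (g i) (liftBlk (blk i) ι)) (BlockNorm.ofBlocks (g i) (liftBlk (blk i ∘ π i) ι))
      (idef (pull (liftMap (π i) ι)) (pull (liftMap (π i) ι)) (D' i μ) (D i μ)) (fun y y' => m₀ * θ i * Real.exp (-(δ * (g i).dist y y'))))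
    (hDD₃ : ∀ i, HasMaj (BlockNorm.ofBlocks (g i) (liftBlk (blk i) ι)) (BlockNorm.ofBlocks (g i) (liftBlk (blk i ∘ π i) ι))
      (idef (pull (liftMap (π i) ι)) (pull (liftMap (π i) ι)) (D₃' i) (D₃ i)) (fun y y' => m₀ * θ i * Real.exp (-(δ * (g i).dist y y'))))
    (hS : ∀ i ν, HasMaj (BlockNorm.ofBlocks (g i) (liftBlk (blk i) ι)) (BlockNorm.ofBlocks (g i) (liftBlk (blk i) ι)) (G i ∘ₗ fgradAdj (n i) (liftEquiv (τ i ν) ι))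
      (fun y y' => β * Real.exp (-(δ * (g i).dist y y'))))
    (hS' : ∀ i ν, HasMaj (BlockNorm.ofBlocks (g i) (liftBlk (blk i ∘ π i) ι)) (BlockNorm.ofBlocks (g i) (liftBlk (blk i ∘ π i) ι)) (G' i ∘ₗ fgradAdj (n' i) (liftEquiv (τ' i ν) ι))
      (fun y y' => β * Real.exp (-(δ * (g i).dist y y'))))
    (hDS : ∀ i ν, HasMaj (BlockNorm.ofBlocks (g i) (liftBlk (blk i) ι)) (BlockNorm.ofBlocks (g i) (liftBlk (blk i ∘ π i) ι))
      (idef (pull (liftMap (π i) ι)) (pull (liftMap (π i) ι)) (G' i ∘ₗ fgradAdj (n' i) (liftEquiv (τ' i ν) ι)) (G i ∘ₗ fgradAdj (n i) (liftEquiv (τ i ν) ι)))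
      (fun y y' => m₀ * θ i * Real.exp (-(δ * (g i).dist y y'))))
    (hSh : ∀ i μ, HasMaj (BlockNorm.ofBlocks (g i) (liftBlk (blk i) ι)) (BlockNorm.ofBlocks (g i) (liftBlk (blk i) ι)) (pull (liftEquiv (τ i μ) ι)) (fun y y' => cT * Real.exp (-(δ * (g i).dist y y'))))
    (hSh' : ∀ i μ, HasMaj (BlockNorm.ofBlocks (g i) (liftBlk (blk i ∘ π i) ι)) (BlockNorm.ofBlocks (g i) (liftBlk (blk i ∘ π i) ι)) (pull (liftEquiv (τ' i μ) ι))
      (fun y y' => cT * Real.exp (-(δ * (g i).dist y y'))))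
    (hLt : ∀ i (U : (Bf i).Cfg) (α₀ : ℝ), (Bf i).Reg335 c35 α₀ U → 0 < α₀ → 1 ≤ (g i).M → c35 * (g i).M * α₀ ≤ r₀ →
      TwoSidedLetters J ι (π i) (τ i) (τ' i) (n i) (n' i) (κ * (c35 * (g i).M * α₀)) (θ i) (cfgF i U) (cfgC i U))
    (hDSh : ∀ i (U : (Bf i).Cfg) (α₀ : ℝ), (Bf i).Reg335 c35 α₀ U → 0 < α₀ → 1 ≤ (g i).M → c35 * (g i).M * α₀ ≤ r₀ →
      ∀ μ, HasMaj (BlockNorm.ofBlocks (g i) (liftBlk (liftBlk (blk i) ι) J)) (BlockNorm.ofBlocks (g i) (liftBlk (blk i ∘ π i) ι))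
        (idef (pull (liftMap (π i) ι)) (pull (liftMap (π i) ι)) (pull (liftEquiv (τ' i μ) ι)) (pull (liftEquiv (τ i μ) ι)) ∘ₗ
          (mmulOp ((cfgC i U).2 (Sum.inl μ) ∘ ⇑(τ i μ).symm) ∘ₗ sumJ fun ν => G i ∘ₗ fgradAdj (n i) (liftEquiv (τ i ν) ι)))
        (fun y y' => mT * (κ * (c35 * (g i).M * α₀)) * θ i * Real.exp (-(δ * (g i).dist y y')))) :
    NE2PlusOperatorM1 c35 (fun i => bgInstanceM₂R (blk i) (π i) (nsh i) (Bc i) (Bf i) (P i))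
      (fun i => bgFamilyM₂RC J ι (blk i) (π i) (nsh i) (Bc i) (Bf i) (P i) (cfgF i) (cfgC i) (τ i) (τ' i) (n i) (n' i) (ν i) (G i) (D₃ i) (D i) (G' i) (D₃' i) (D' i)) := by
  have hnJ : (0 : ℝ) ≤ Fintype.card J := Nat.cast_nonneg _
  have hnJ2 : (0 : ℝ) ≤ Fintype.card (J ⊕ J) := Nat.cast_nonneg _
  have hJ1 : (1 : ℝ) ≤ 1 + Fintype.card (J ⊕ J) := le_add_of_nonneg_right hnJ2
  have hJ0 : (0 : ℝ) < 1 + Fintype.card (J ⊕ J) := lt_of_lt_of_le one_pos hJ1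
  have hκc : 0 < κ * c35 := mul_pos hκ hc35
  -- the guard constant of the perturbation series and the by-parts one
  set a₁ : ℝ := (2 * ((κ * c35) * (1 + Fintype.card (J ⊕ J))) * (β * cr + 1))⁻¹ with ha₁_def
  set a₂ : ℝ := (2 * ((cT + 1) * (κ * c35) * Fintype.card J * β * (cr * cr * cr) + 1))⁻¹ with ha₂_def
  have hden₁ : 0 < 2 * ((κ * c35) * (1 + Fintype.card (J ⊕ J))) * (β * cr + 1) := by positivity
  have hden₂ : 0 < 2 * ((cT + 1) * (κ * c35) * Fintype.card J * β * (cr * cr * cr) + 1) := by positivity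
  have ha₁ : 0 < a₁ := inv_pos.2 hden₁
  have ha₂ : 0 < a₂ := inv_pos.2 hden₂
  set a₀ : ℝ := min (min a₁ a₂) (r₀ / c35) with ha₀_def
  have ha₀ : 0 < a₀ := lt_min (lt_min ha₁ ha₂) (div_pos hr₀ hc35)
  have ha₀₁ : a₀ ≤ a₁ := (min_le_left _ _).trans (min_le_left _ _)
  have ha₀₂ : a₀ ≤ a₂ := (min_le_left _ _).trans (min_le_right _ _)
  have ha₀r : c35 * a₀ ≤ r₀ := by
    have h := min_le_right (min a₁ a₂) (r₀ / c35)
    rw [← ha₀_def] at h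
    calc c35 * a₀ ≤ c35 * (r₀ / c35) := mul_le_mul_of_nonneg_left h hc35.le
      _ = r₀ := mul_div_cancel₀ r₀ hc35.ne'
  have hA0 : 0 ≤ κ * c35 * a₀ := by positivity
  have hq : β * ((1 + Fintype.card (J ⊕ J)) * (κ * c35 * a₀)) * cr ≤ 1 / 2 := by
    have hq₁ : β * ((1 + Fintype.card (J ⊕ J)) * (κ * c35 * a₁)) * cr ≤ 1 / 2 := by
      have h1 : β * ((1 + Fintype.card (J ⊕ J)) * (κ * c35 * a₁)) * cr = (β * cr) * ((κ * c35) * (1 + Fintype.card (J ⊕ J)) * a₁) := by ring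
      have h2 : (κ * c35) * (1 + Fintype.card (J ⊕ J)) * a₁ = (2 * (β * cr + 1))⁻¹ := by
        rw [ha₁_def]; field_simp
      rw [h1, h2, ← div_eq_mul_inv, div_le_iff₀ (by positivity)]
      nlinarith [mul_nonneg hβ hcr]
    refine le_trans ?_ hq₁
    have h0 : 0 ≤ β * ((1 + Fintype.card (J ⊕ J)) * (κ * c35)) * cr := by positivity
    nlinarith
  have hq2 : 1 * rowConst (Fintype.card J) β cT (κ * c35 * a₀) cr * cr * cr ≤ 1 / 2 :=
    rowConst_small hnJ hβ hcT hκc.le hcr ha₀₂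
  have hC0 : 0 ≤ bgConst β cr m₀ (1 + Fintype.card (J ⊕ J)) (κ * c35 * a₀) := bgConst_nonneg hβ hcr hm₀ hJ0.le hA0
  have hC1 : 0 ≤ bgConst1 β cr m₀ (1 + Fintype.card (J ⊕ J)) (κ * c35 * a₀) := bgConst1_nonneg hβ hcr hm₀ hJ0.le hA0
  have hmT' : 0 ≤ mT * (κ * c35 * a₀) := mul_nonneg hmT hA0
  have hC2 : 0 ≤ bpConst2L (Fintype.card J) (Fintype.card (J ⊕ J)) β cr m₀ (κ * c35 * a₀) cT (mT * (κ * c35 * a₀)) :=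
    bpConst2L_nonneg hnJ hnJ2 hβ hcr hm₀ hA0 hcT hmT' (by linarith)
  have hCC1 : 0 ≤ covConst1 β cr m₀ (1 + Fintype.card (J ⊕ J)) (κ * c35 * a₀) := covConst1_nonneg hβ hcr hm₀ hJ0.le hA0
  have hCC3 : 0 ≤ covConst3 (Fintype.card J) β cr m₀ (1 + Fintype.card (J ⊕ J)) (κ * c35 * a₀) := covConst3_nonneg hnJ hβ hcr hm₀ hJ0.le hA0
  refine ⟨δ - 6 * σ, a₀, bgConst β cr m₀ (1 + Fintype.card (J ⊕ J)) (κ * c35 * a₀) + bgConst1 β cr m₀ (1 + Fintype.card (J ⊕ J)) (κ * c35 * a₀) +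
    bpConst2L (Fintype.card J) (Fintype.card (J ⊕ J)) β cr m₀ (κ * c35 * a₀) cT (mT * (κ * c35 * a₀)) +
    covConst1 β cr m₀ (1 + Fintype.card (J ⊕ J)) (κ * c35 * a₀) + covConst3 (Fintype.card J) β cr m₀ (1 + Fintype.card (J ⊕ J)) (κ * c35 * a₀) + 1, γ, by linarith, ha₀,
    by linarith, hγ, fun i α₀ hα₀ hMα U hreg => ?_⟩
  have hM' : 1 ≤ (g i).M := hM1 i
  have hMα' : (g i).M * α₀ ≤ a₀ := hMα
  have hgd : c35 * (g i).M * α₀ ≤ r₀ := by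
    calc c35 * (g i).M * α₀ = c35 * ((g i).M * α₀) := by ring
      _ ≤ c35 * a₀ := mul_le_mul_of_nonneg_left hMα' hc35.le
      _ ≤ r₀ := ha₀r
  have hsc : κ * (c35 * (g i).M * α₀) ≤ κ * c35 * a₀ := by
    calc κ * (c35 * (g i).M * α₀) = κ * c35 * ((g i).M * α₀) := by ring
      _ ≤ κ * c35 * a₀ := mul_le_mul_of_nonneg_left hMα' hκc.le
  -- the letters and the shift-defect row letter under the guard: scale `κc₃₅Mα₀ ≤ κc₃₅a₀`, window `c₃₅Mα₀ ≤ c₃₅a₀ ≤ r₀`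
  have hLt' : TwoSidedLetters J ι (π i) (τ i) (τ' i) (n i) (n' i) (κ * c35 * a₀) (θ i) (cfgF i U) (cfgC i U) :=
    (hLt i U α₀ hreg hα₀ hM' hgd).mono hsc (hθ i)
  have hDSh' : ∀ μ, HasMaj (BlockNorm.ofBlocks (g i) (liftBlk (liftBlk (blk i) ι) J)) (BlockNorm.ofBlocks (g i) (liftBlk (blk i ∘ π i) ι))
      (idef (pull (liftMap (π i) ι)) (pull (liftMap (π i) ι)) (pull (liftEquiv (τ' i μ) ι)) (pull (liftEquiv (τ i μ) ι)) ∘ₗ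
        (mmulOp ((cfgC i U).2 (Sum.inl μ) ∘ ⇑(τ i μ).symm) ∘ₗ sumJ fun ν => G i ∘ₗ fgradAdj (n i) (liftEquiv (τ i ν) ι)))
      (fun y y' => mT * (κ * c35 * a₀) * θ i * Real.exp (-(δ * (g i).dist y y'))) := fun μ =>
    (hDSh i U α₀ hreg hα₀ hM' hgd μ).mono fun y y' => by
      have h2 : 0 ≤ θ i * Real.exp (-(δ * (g i).dist y y')) := mul_nonneg (hθ i) (Real.exp_nonneg _)
      nlinarith [mul_le_mul_of_nonneg_left hsc hmT]
  have key := etaRateIneq342_twoSidedCov_of_letters (J := J) (ι := ι) (B := Bf i) (blk i) (π i) (htri i) (hd i) (hd0 i) hσ hcr (hrow i) (hη i) (hL i) (hlen i) hσδ.le hβ hm₀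
    (hθ i) (hθγ i) hA0 hq hcT hmT' hq2 (hn'0 i) (hn'n i) (hnθ i) (hθ1 i) (ν := ν i) (hG i) (hD i) (hG' i) (hD' i) (hD₃' i) (hDG i) (hDD i) (hDD₃ i) (hS i) (hS' i) (hDS i)
    (hSh i) (hSh' i) (cfgF := cfgF i) (cfgC := cfgC i) (U := U) hLt' hDSh'
  intro k lam y y' hs
  refine (key k lam y y' hs).trans ?_
  have hpref : 0 ≤ B9.pref4 ((bgInstanceM₂R (blk i) (π i) (nsh i) (Bc i) (Bf i) (P i)).gc.len y) k := by
    have : 1 ≤ B9.pref4 ((opGeo (g i) (X i × ι) (liftBlk (blk i) ι)).len y) k := by rw [opGeo_len]; exact one_le_pref4 (hlen i y) k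
    exact zero_le_one.trans this
  have hrf : 0 ≤ max (rateFactor (bgInstanceM₂R (blk i) (π i) (nsh i) (Bc i) (Bf i) (P i)).gc γ y) (rateFactor (bgInstanceM₂R (blk i) (π i) (nsh i) (Bc i) (Bf i) (P i)).gc γ y') :=
    (T4EtaRate.rateFactor_nonneg (g := opGeo (g i) (X i × ι) (liftBlk (blk i) ι)) (hη i).le (hL i).le γ y).trans (le_max_left _ _)
  have hnorm : 0 ≤ (bgInstanceM₂R (blk i) (π i) (nsh i) (Bc i) (Bf i) (P i)).gc.supNorm lam := Real.iSup_nonneg fun x => abs_nonneg _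
  have hE : 0 ≤ Real.exp (-((δ - 6 * σ) * (bgInstanceM₂R (blk i) (π i) (nsh i) (Bc i) (Bf i) (P i)).gc.dist y y')) := Real.exp_nonneg _
  exact mul_le_mul_of_nonneg_right (mul_le_mul_of_nonneg_right (mul_le_mul_of_nonneg_right
    (mul_le_mul_of_nonneg_right (le_add_of_nonneg_right zero_le_one) hpref) hE) hrf) hnorm

end Node

end Summit.QuantumFields.YangMills.BalabanUVNodes.N15.BackgroundLayer

end
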